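import Mathlib
import HarnessLib
import Summits.QuantumFields.YangMills.Theorems.ComplexCouplingChannelContinuumLegGivenGapAlternatingArraysDefs
import Summits.QuantumFields.YangMills.Theorems.ComplexCouplingChannelContinuumLegGivenGapProductToUniformLinearity
import Summits.QuantumFields.YangMills.Theorems.ComplexCouplingChannelContinuumLegGivenGapProductToUniformNearDiagonal
import Summits.QuantumFields.YangMills.Theorems.ComplexCouplingChannelContinuumLegGivenGapProductToUniformOffsets
import Summits.QuantumFields.YangMills.Theorems.ComplexCouplingChannelContinuumLegGivenGapProductToUniformLocalBound
import Summits.QuantumFields.YangMills.Theorems.ComplexCouplingChannelContinuumLegGivenGapProductToUniformGevreyGlue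
import Summits.QuantumFields.YangMills.Theorems.ComplexCouplingChannelContinuumLegGivenGapProductToUniformGevreyStep

import Summits.QuantumFields.YangMills.Theorems.ComplexCouplingChannelContinuumLegGivenGapProductToUniformDefs
/-!
# `stub_productToUniform` of line `alternating-curvature-arrays` (crux `ContinuumLegGivenGap`, stmt-QuantumFields-15828):
the lattice decomposition identity and the arities 0 and 1

Proof-only companion of `…ProductToUniformDefs` (the Whitney system): exact centring at arity one
(`ptu_centredMoment_one`, `ptu_canonDistribution_one_eq_zero`), the arity-zero evaluation bound
(`ptu_norm_canonDistribution_zero_le`), and the LATTICE DECOMPOSITION `ptu_canonDistribution_decomp` behind the assembly: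
if the normaliser does not vanish at the scaled box configurations, the outer cut-offs are `1` on the supports of the inner
ones and the piece weights have temperate growth, then the canonical distribution splits into the NEAR, OUTER and FAR lattice
sums (insert `1 = (near + out + ∑ φ*)/W`), the FAR pieces already in the form `∑ₓ (∏ᵢ χᵢ(a xᵢ)) G(a x⃗) c(x⃗)` of the landed
`localBound_of_productBound` with `G = (φ̃/W) • F`.  No definitions. [folklore]
-/

set_option autoImplicit false

noncomputable section

open scoped Classical

namespace Summit.QuantumFields.YangMills.Theorems.ContinuumLegGivenGap

open scoped SchwartzMap BigOperators ContDiff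
open MeasureTheory Filter Topology
open Literature.MathematicalPhysics.QuantumFieldTheory Literature.MathematicalPhysics.QuantumLattice
  Literature.MathematicalPhysics.AQFT
open Literature.Probability.LatticeModels (box Site)
open Summit.QuantumFields.YangMills.Cruxes.ContinuumLimitOnTrajectory.TwoOrbitSynchronisation
  (PlaqIdx plaq canonDistribution UUVB PolyVolumeGrowth)
open Summit.QuantumFields.YangMills.Theorems.ContinuumLimitExists.Negative (obsOf centredMoment)
open Summit.QuantumFields.YangMills.Theorems.ContinuumLegGivenGap.AlternatingArrays

section Glue

variable {G : Type} [Group G] [TopologicalSpace G] [IsTopologicalGroup G] [CompactSpace G]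
  [MeasurableSpace G] [BorelSpace G]

/-- **Exact centring at arity one**: every centred one-point moment of a plaquette species vanishes (translation
invariance of the torus Wilson state, `integral_comp_configShift_torusLift`). [folklore] -/
theorem ptu_centredMoment_one (r : LatticeRep G) (L : ℕ) (β : ℝ) (q : PlaqIdx) (x : Fin 1 → Site 4) :
    centredMoment r L β 1 (fun _ => some q) x = 0 := by
  haveI : NeZero (2 * L + 1) := ⟨Nat.succ_ne_zero _⟩
  haveI : IsProbabilityMeasure (wilsonMeasure (d := 4) (L := 2 * L + 1) (G := G) r.ρ β) :=
    isProbabilityMeasure_wilsonMeasure r.ρ r.continuous β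
  unfold centredMoment
  simp only [Fin.prod_univ_one]
  have hmeas : Measurable (obsOf r (some q)).F := (obsOf r (some q)).measurable
  obtain ⟨C, hC⟩ := (obsOf r (some q)).bounded
  have hint : Integrable (fun U : GaugeConfig 4 (2 * L + 1) G =>
      (obsOf r (some q)).F (configShift (-(x 0)) (torusLift (2 * L + 1) U))) (wilsonMeasure r.ρ β) :=
    Integrable.of_bound ((hmeas.comp ((configShift _).measurable.comp (measurable_torusLift _))).aestronglyMeasurable)
      C (Eventually.of_forall fun U => by rw [Real.norm_eq_abs]; exact hC _)
  rw [integral_sub hint (integrable_const _), integral_const, probReal_univ, one_smul,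
    Summit.QuantumFields.YangMills.Cruxes.ContinuumLimitOnTrajectory.TwoOrbitSynchronisation.integral_comp_configShift_torusLift
      r.ρ β (2 * L + 1) (-(x 0)) hmeas]
  unfold wilsonTorusMean
  exact sub_self _

/-- **Arity one**: the canonical distribution of a single plaquette vanishes identically. [folklore] -/
theorem ptu_canonDistribution_one_eq_zero (r : LatticeRep G) (sch : SpeciesScheme (YMSpecies G)) (k : ℕ)
    (q : Fin 1 → PlaqIdx) (F : 𝓢((Fin 1 → EuclideanSpace ℝ (Fin 4)), ℂ)) :
    canonDistribution r sch k 1 (fun i => plaq r (q i)) F = 0 := by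
  rw [linearity_canonDistribution_eq_sum]
  refine Finset.sum_eq_zero fun x _ => ?_
  have h : centredMoment r (sch.L k) (sch.β k) 1 (fun i => some (q i)) (fun i => (x i : Site 4)) = 0 := by
    have hq : (fun i : Fin 1 => some (q i)) = fun _ => some (q 0) := funext fun i => by rw [Subsingleton.elim i 0]
    rw [hq]
    exact ptu_centredMoment_one r _ _ (q 0) _
  rw [h, Complex.ofReal_zero, mul_zero]

/-- **Arity zero**: the canonical distribution is the evaluation at the point, bounded by `|F|₀`. [folklore] -/
theorem ptu_norm_canonDistribution_zero_le (r : LatticeRep G) (sch : SpeciesScheme (YMSpecies G)) (k : ℕ)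
    (q : Fin 0 → PlaqIdx) (F : 𝓢((Fin 0 → EuclideanSpace ℝ (Fin 4)), ℂ)) :
    ‖canonDistribution r sch k 0 (fun i => plaq r (q i)) F‖ ≤ schwartzNorm 0 F :=
  Summit.QuantumFields.YangMills.Theorems.ContinuumLimitExists.Negative.norm_canonDistribution_obsOf_zero_le r sch k
    (fun i => some (q i)) F

/-- **The lattice decomposition** behind the assembly: if the normaliser does not vanish at the scaled box
configurations, the outer cut-offs are `1` on the supports of the inner ones, and the piece weights have temperate growth,
then the canonical distribution splits into the NEAR, OUTER and FAR lattice sums (insert `1 = (near + out + ∑ φ*)/W`; the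
FAR pieces are already in the form `∑ₓ (∏ᵢ χᵢ(a xᵢ)) G(a x⃗) c(x⃗)` of `localBound_of_productBound` with
`G = (φ̃/W) • F`). [folklore] -/
theorem ptu_canonDistribution_decomp (r : LatticeRep G) (sch : SpeciesScheme (YMSpecies G)) (k p : ℕ)
    (q : Fin p → PlaqIdx) (F : 𝓢((Fin p → EuclideanSpace ℝ (Fin 4)), ℂ))
    (hW : ∀ x : Fin p → ↥(box 4 (sch.L k)), ptuW (sch.a k) (sch.L k) p (fun i => sch.a k • siteToE (↑(x i) : Site 4)) ≠ 0)
    (hχ : ∀ m ∈ ptuLevels (sch.L k) p, ∀ vz ∈ ptuIdx (sch.L k) m p, ∀ (i : Fin p) (u : EuclideanSpace ℝ (Fin 4)),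
      ptuChiFun (sch.a k) m p vz.1 (vz.2 i) u ≠ 0 → ptuChiTildeFun (sch.a k) m p vz.1 (vz.2 i) u = 1)
    (hT : ∀ m ∈ ptuLevels (sch.L k) p, ∀ vz ∈ ptuIdx (sch.L k) m p,
      (fun y : (Fin p → EuclideanSpace ℝ (Fin 4)) => ((ptuWeight (sch.a k) (sch.L k) p m vz.1 vz.2 y : ℝ) : ℂ)).HasTemperateGrowth) :
    canonDistribution r sch k p (fun i => plaq r (q i)) F =
      (∑ x : Fin p → ↥(box 4 (sch.L k)),
        ((ptuNear (sch.a k) p (fun i => sch.a k • siteToE (↑(x i) : Site 4)) /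
            ptuW (sch.a k) (sch.L k) p (fun i => sch.a k • siteToE (↑(x i) : Site 4)) : ℝ) : ℂ) *
          F (fun i => sch.a k • siteToE (↑(x i) : Site 4)) *
          ((centredMoment r (sch.L k) (sch.β k) p (fun i => some (q i)) (fun i => (x i : Site 4)) : ℝ) : ℂ)) +
      (∑ x : Fin p → ↥(box 4 (sch.L k)),
        ((ptuOut (sch.a k) (sch.L k) p (fun i => sch.a k • siteToE (↑(x i) : Site 4)) /
            ptuW (sch.a k) (sch.L k) p (fun i => sch.a k • siteToE (↑(x i) : Site 4)) : ℝ) : ℂ) *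
          F (fun i => sch.a k • siteToE (↑(x i) : Site 4)) *
          ((centredMoment r (sch.L k) (sch.β k) p (fun i => some (q i)) (fun i => (x i : Site 4)) : ℝ) : ℂ)) +
      ∑ m ∈ ptuLevels (sch.L k) p, ∑ vz ∈ ptuIdx (sch.L k) m p, ∑ x : Fin p → ↥(box 4 (sch.L k)),
        (∏ i, ((ptuChi (sch.a k) m p vz.1 (vz.2 i) (sch.a k • siteToE (↑(x i) : Site 4)) : ℝ) : ℂ)) *
          (SchwartzMap.smulLeftCLM ℂ (fun y : (Fin p → EuclideanSpace ℝ (Fin 4)) => ((ptuWeight (sch.a k) (sch.L k) p m vz.1 vz.2 y : ℝ) : ℂ)) F)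
            (fun i => sch.a k • siteToE (↑(x i) : Site 4)) *
          ((centredMoment r (sch.L k) (sch.β k) p (fun i => some (q i)) (fun i => (x i : Site 4)) : ℝ) : ℂ) := by
  -- abbreviations
  set a : ℝ := sch.a k with ha
  set L : ℕ := sch.L k with hL
  set y : (Fin p → ↥(box 4 L)) → (Fin p → EuclideanSpace ℝ (Fin 4)) := fun x i => a • siteToE (↑(x i) : Site 4) with hy
  set c : (Fin p → ↥(box 4 L)) → ℂ := fun x =>
    ((centredMoment r L (sch.β k) p (fun i => some (q i)) (fun i => (x i : Site 4)) : ℝ) : ℂ) with hc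
  -- the far summands are `(φ*/W) F c`
  have hfar : ∀ m ∈ ptuLevels L p, ∀ vz ∈ ptuIdx L m p, ∀ x : Fin p → ↥(box 4 L),
      (∏ i, ((ptuChi a m p vz.1 (vz.2 i) (y x i) : ℝ) : ℂ)) *
          (SchwartzMap.smulLeftCLM ℂ (fun y' : (Fin p → EuclideanSpace ℝ (Fin 4)) => ((ptuWeight a L p m vz.1 vz.2 y' : ℝ) : ℂ)) F) (y x) * c x =
        ((ptuPhiStar a m p vz.1 vz.2 (y x) / ptuW a L p (y x) : ℝ) : ℂ) * F (y x) * c x := by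
    intro m hm vz hvz x
    rw [SchwartzMap.smulLeftCLM_apply_apply (hT m hm vz hvz), smul_eq_mul, ← Complex.ofReal_prod]
    simp only [ptuChi_apply]
    have hprod : (∏ i, ptuChiFun a m p vz.1 (vz.2 i) (y x i)) = ptuPhiStar a m p vz.1 vz.2 (y x) := rfl
    rw [hprod]
    by_cases h0 : ptuPhiStar a m p vz.1 vz.2 (y x) = 0
    · rw [h0, zero_div, Complex.ofReal_zero]; simp
    · have h1 : ptuPhiTilde a m p vz.1 vz.2 (y x) = 1 := by
        unfold ptuPhiTilde
        refine Finset.prod_eq_one fun i _ => hχ m hm vz hvz i _ ?_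
        exact (Finset.prod_ne_zero_iff.1 h0) i (Finset.mem_univ i)
      unfold ptuWeight
      rw [h1, Complex.ofReal_div, Complex.ofReal_one, Complex.ofReal_div]
      ring
  -- the pointwise identity `F c = (near/W) F c + (out/W) F c + ∑∑ (φ*/W) F c`
  have hpt : ∀ x : Fin p → ↥(box 4 L), F (y x) * c x =
      ((ptuNear a p (y x) / ptuW a L p (y x) : ℝ) : ℂ) * F (y x) * c x +
        ((ptuOut a L p (y x) / ptuW a L p (y x) : ℝ) : ℂ) * F (y x) * c x +
        ∑ m ∈ ptuLevels L p, ∑ vz ∈ ptuIdx L m p,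
          ((ptuPhiStar a m p vz.1 vz.2 (y x) / ptuW a L p (y x) : ℝ) : ℂ) * F (y x) * c x := by
    intro x
    have hWx : ptuW a L p (y x) ≠ 0 := hW x
    have key : ptuNear a p (y x) / ptuW a L p (y x) + ptuOut a L p (y x) / ptuW a L p (y x) +
        ∑ m ∈ ptuLevels L p, ∑ vz ∈ ptuIdx L m p, ptuPhiStar a m p vz.1 vz.2 (y x) / ptuW a L p (y x) = 1 := by
      simp_rw [← Finset.sum_div]
      rw [← add_div, ← add_div, div_eq_one_iff_eq hWx]
      rfl
    have key' : ((ptuNear a p (y x) / ptuW a L p (y x) : ℝ) : ℂ) + ((ptuOut a L p (y x) / ptuW a L p (y x) : ℝ) : ℂ) +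
        ∑ m ∈ ptuLevels L p, ∑ vz ∈ ptuIdx L m p,
          ((ptuPhiStar a m p vz.1 vz.2 (y x) / ptuW a L p (y x) : ℝ) : ℂ) = 1 := by
      exact_mod_cast key
    calc F (y x) * c x = (1 : ℂ) * (F (y x) * c x) := by rw [one_mul]
      _ = (((ptuNear a p (y x) / ptuW a L p (y x) : ℝ) : ℂ) + ((ptuOut a L p (y x) / ptuW a L p (y x) : ℝ) : ℂ) +
            ∑ m ∈ ptuLevels L p, ∑ vz ∈ ptuIdx L m p,
              ((ptuPhiStar a m p vz.1 vz.2 (y x) / ptuW a L p (y x) : ℝ) : ℂ)) * (F (y x) * c x) := by rw [key']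
      _ = _ := by simp only [add_mul, Finset.sum_mul, mul_assoc]
  -- sum over configurations and exchange the sums
  rw [linearity_canonDistribution_eq_sum]
  have hsum : ∑ x : Fin p → ↥(box 4 L), F (y x) * c x =
      (∑ x : Fin p → ↥(box 4 L), ((ptuNear a p (y x) / ptuW a L p (y x) : ℝ) : ℂ) * F (y x) * c x) +
      (∑ x : Fin p → ↥(box 4 L), ((ptuOut a L p (y x) / ptuW a L p (y x) : ℝ) : ℂ) * F (y x) * c x) +
      ∑ m ∈ ptuLevels L p, ∑ vz ∈ ptuIdx L m p, ∑ x : Fin p → ↥(box 4 L),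
        ((ptuPhiStar a m p vz.1 vz.2 (y x) / ptuW a L p (y x) : ℝ) : ℂ) * F (y x) * c x := by
    rw [Finset.sum_congr rfl fun x _ => hpt x, Finset.sum_add_distrib, Finset.sum_add_distrib]
    congr 1
    rw [Finset.sum_comm]
    exact Finset.sum_congr rfl fun m _ => Finset.sum_comm
  rw [hsum]
  congr 1
  refine Finset.sum_congr rfl fun m hm => Finset.sum_congr rfl fun vz hvz => Finset.sum_congr rfl fun x _ => ?_
  exact (hfar m hm vz hvz x).symm

end Glue

/-- **Arity one, closed form** (registered anchor of this file): for every compact gauge group, representation, scheme,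
step and single-plaquette string, the canonical one-point distribution vanishes identically. [folklore] -/
theorem ptuGlue_canonDistribution_one :
    ∀ (G : Type) [Group G] [TopologicalSpace G] [IsTopologicalGroup G] [CompactSpace G] [MeasurableSpace G]
      [BorelSpace G] (r : LatticeRep G) (sch : SpeciesScheme (YMSpecies G)) (k : ℕ) (q : Fin 1 → PlaqIdx)
      (F : 𝓢((Fin 1 → EuclideanSpace ℝ (Fin 4)), ℂ)), canonDistribution r sch k 1 (fun i => plaq r (q i)) F = 0 :=
  fun _ _ _ _ _ _ _ r sch k q F => ptu_canonDistribution_one_eq_zero r sch k q F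

end Summit.QuantumFields.YangMills.Theorems.ContinuumLegGivenGap

end
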